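import Summits.KontsevichZagierPeriods.KontsevichZagierPeriods.Theses.FermatIsogeny
import Literature.NumberTheory.Transcendental.BetaSymbolGroup

/-!
# `BetaProductHodgeType` (proposed split child 1/2 of crux `BetaProductSector`, stmt-KontsevichZagierPeriods-3898) — birth skeleton

Statement (VALUE ⇒ HODGE TYPE, the transcendence atom of crux 4 of route FermatIsogeny): if
`B(a,b)B(e,d) = q·B(a',b')B(e',d')` with `q` real algebraic (eight positive rationals, `B = ProbabilityTheory.beta`),
then the datum is of Deligne–Koblitz–Ogus Hodge type at weight `0`: for every `u ≥ 1` coprime to the eight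
denominators, `({ua}+{ub}−{u(a+b)}) + ({ue}+{ud}−{u(e+d)}) = ({ua'}+{ub'}−{u(a'+b')}) + ({ue'}+{ud'}−{u(e'+d')})`.

Plan (two stubs, composition trivial):
* `stub_relSpan_of_algebraic` — LANG–ROHRLICH, (2,2) weight-0, in RELATOR FORM over the tree's Beta symbol group
  (`Literature.NumberTheory.Transcendental.BetaSymbol`): an algebraic (2,2) Beta-product identity forces the symbol
  difference `([a,b]+[e,d]) − ([a',b']+[e',d'])` to have a positive multiple in `RelSpan` (the ℤ-span of symmetry,
  translation, Dirichlet re-association, Gauss multiplication, Euler reflection, unit). Conjecture-grade (the standard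
  form of the conjecture: Lang, Rohrlich; Waldschmidt's survey), in which the linear sub-case is the theorem of
  Wolfart–Wüstholz 1985 and in which refuters can run level-by-level lattice computations (Koblitz–Ogus lattice
  `H_D / S_D`, cf. TerasomaMultiplication's DasGapTwelve census).
* `stub_hodge_of_relSpan` — RELATORS ARE OF HODGE TYPE (provable combinatorics): a positive multiple in `RelSpan` forces
  the weight-0 Hodge identity at every `u` coprime to the eight denominators (each standard relator satisfies it at units
  coprime to ITS denominators — symmetry / Dirichlet / unit identically, translation `{u(a+1)} = {ua}`, reflection
  `{ua}+{−ua} = 1 = 2{u/2}` for odd `u`, Gauss multiplication by Hermite's identity `Σ_{m<n}{v+m/n} = {nv}+(n−1)/2`;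
  a witness through foreign levels is handled by lifting the unit `u` with `ZMod.unitsMap_surjective`).
`BetaProductHodgeType_of` concludes the child's statement verbatim (re-point its type at the route decl
`…Theses.FermatIsogeny.BetaProductHodgeType` once the split is applied, then `ledger skeleton check … --crux <child item>`).
-/

set_option linter.dupNamespace false

noncomputable section

namespace Summit.KontsevichZagierPeriods.KontsevichZagierPeriods.Cruxes.BetaProductHodgeType.Birth

/-- Stub 1 — Lang–Rohrlich, (2,2) weight 0, relator form: an algebraic (2,2) Beta-product identity has a positive
multiple of its symbol difference in the span of the standard relators. [cite: Waldschmidt2006] [cite: Deligne1982HodgeCycles, §7] -/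
theorem stub_relSpan_of_algebraic : ∀ (a b e d a' b' e' d' : ℚ) (q : ℝ), 0 < a → 0 < b → 0 < e → 0 < d → 0 < a' → 0 < b' → 0 < e' → 0 < d' → IsAlgebraic ℚ q → ProbabilityTheory.beta (a:ℝ) b * ProbabilityTheory.beta (e:ℝ) d = q * (ProbabilityTheory.beta (a':ℝ) b' * ProbabilityTheory.beta (e':ℝ) d') → ∃ n : ℕ, 0 < n ∧ n • ((Literature.NumberTheory.Transcendental.BetaSymbol.bsym a b + Literature.NumberTheory.Transcendental.BetaSymbol.bsym e d) - (Literature.NumberTheory.Transcendental.BetaSymbol.bsym a' b' + Literature.NumberTheory.Transcendental.BetaSymbol.bsym e' d')) ∈ Literature.NumberTheory.Transcendental.BetaSymbol.RelSpan := by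
  sorry

/-- Stub 2 — the standard relators are of Hodge type: a positive multiple in `RelSpan` forces the weight-0 Hodge
identity at every unit coprime to the eight denominators. [cite: Deligne1982HodgeCycles, Thm. 7.18] [cite: AndrewsAskeyRoy1999, Thm 1.8.1] -/
theorem stub_hodge_of_relSpan : ∀ (a b e d a' b' e' d' : ℚ), 0 < a → 0 < b → 0 < e → 0 < d → 0 < a' → 0 < b' → 0 < e' → 0 < d' → (∃ n : ℕ, 0 < n ∧ n • ((Literature.NumberTheory.Transcendental.BetaSymbol.bsym a b + Literature.NumberTheory.Transcendental.BetaSymbol.bsym e d) - (Literature.NumberTheory.Transcendental.BetaSymbol.bsym a' b' + Literature.NumberTheory.Transcendental.BetaSymbol.bsym e' d')) ∈ Literature.NumberTheory.Transcendental.BetaSymbol.RelSpan) → ∀ u : ℕ, 0 < u → Nat.Coprime u a.den → Nat.Coprime u b.den → Nat.Coprime u e.den → Nat.Coprime u d.den → Nat.Coprime u a'.den → Nat.Coprime u b'.den → Nat.Coprime u e'.den → Nat.Coprime u d'.den → (Int.fract ((u:ℚ) * a) + Int.fract ((u:ℚ) * b) - Int.fract ((u:ℚ) * (a + b))) + (Int.fract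 ((u:ℚ) * e) + Int.fract ((u:ℚ) * d) - Int.fract ((u:ℚ) * (e + d))) = (Int.fract ((u:ℚ) * a') + Int.fract ((u:ℚ) * b') - Int.fract ((u:ℚ) * (a' + b'))) + (Int.fract ((u:ℚ) * e') + Int.fract ((u:ℚ) * d') - Int.fract ((u:ℚ) * (e' + d'))) := by
  sorry

/-- The composition, arrow form. [cite: Deligne1982HodgeCycles, Thm. 7.18] -/
theorem betaProductHodgeType_of_stubs
    (h1 : ∀ (a b e d a' b' e' d' : ℚ) (q : ℝ), 0 < a → 0 < b → 0 < e → 0 < d → 0 < a' → 0 < b' → 0 < e' → 0 < d' → IsAlgebraic ℚ q → ProbabilityTheory.beta (a:ℝ) b * ProbabilityTheory.beta (e:ℝ) d = q * (ProbabilityTheory.beta (a':ℝ) b' * ProbabilityTheory.beta (e':ℝ) d') → ∃ n : ℕ, 0 < n ∧ n • ((Literature.NumberTheory.Transcendental.BetaSymbol.bsym a b + Literature.NumberTheory.Transcendental.BetaSymbol.bsym e d) - (Literature.NumberTheory.Transcendental.BetaSymbol.bsym a' b' + Literature.NumberTheory.Transcendental.BetaSymbol.bsym e' d')) ∈ Li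terature.NumberTheory.Transcendental.BetaSymbol.RelSpan)
    (h2 : ∀ (a b e d a' b' e' d' : ℚ), 0 < a → 0 < b → 0 < e → 0 < d → 0 < a' → 0 < b' → 0 < e' → 0 < d' → (∃ n : ℕ, 0 < n ∧ n • ((Literature.NumberTheory.Transcendental.BetaSymbol.bsym a b + Literature.NumberTheory.Transcendental.BetaSymbol.bsym e d) - (Literature.NumberTheory.Transcendental.BetaSymbol.bsym a' b' + Literature.NumberTheory.Transcendental.BetaSymbol.bsym e' d')) ∈ Literature.NumberTheory.Transcendental.BetaSymbol.RelSpan) → ∀ u : ℕ, 0 < u → Nat.Coprime u a.den → Nat.Coprime u b.den → Nat.Coprime u e.den → Nat.Coprime u d.den → Nat.Coprime u a'.den → Nat.Coprime u b'.den → Nat.Coprime u e'.den → Nat.Coprime u d'.den → (Int.fract ((u:ℚ) * a) + Int.fract ((u:ℚ) * b) - Int.fract ((u:ℚ) * (a + b))) + (Int.fract ((u:ℚ) * e) + Int.fract ((u:ℚ) * d) - Int.fract ((u:ℚ) * (e + d))) = (Int.fract ((u:ℚ) * a') + Int.fract ((u:ℚ) * b') - Int.fract ((u:ℚ) * (a'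 + b'))) + (Int.fract ((u:ℚ) * e') + Int.fract ((u:ℚ) * d') - Int.fract ((u:ℚ) * (e' + d')))) :
    ∀ (a b e d a' b' e' d' : ℚ) (q : ℝ), 0 < a → 0 < b → 0 < e → 0 < d → 0 < a' → 0 < b' → 0 < e' → 0 < d' → IsAlgebraic ℚ q → ProbabilityTheory.beta (a:ℝ) b * ProbabilityTheory.beta (e:ℝ) d = q * (ProbabilityTheory.beta (a':ℝ) b' * ProbabilityTheory.beta (e':ℝ) d') → ∀ u : ℕ, 0 < u → Nat.Coprime u a.den → Nat.Coprime u b.den → Nat.Coprime u e.den → Nat.Coprime u d.den → Nat.Coprime u a'.den → Nat.Coprime u b'.den → Nat.Coprime u e'.den → Nat.Coprime u d'.den → (Int.fract ((u:ℚ) * a) + Int.fract ((u:ℚ) * b) - Int.fract ((u:ℚ) * (a + b))) + (Int.fract ((u:ℚ) * e) + Int.fract ((u:ℚ) * d) - Int.fract ((u:ℚ) * (e + d))) = (Int.fract ((u:ℚ) * a') + Int.fract ((u:ℚ) * b') - Int.fract ((u:ℚ) * (a' + b'))) + (Int.fract ((u:ℚ) * e') + Int.fract ((u:ℚ) * d')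 - Int.fract ((u:ℚ) * (e' + d'))) := by
  intro a b e d a' b' e' d' q ha hb he hd ha' hb' he' hd' hq hid
  exact h2 a b e d a' b' e' d' ha hb he hd ha' hb' he' hd'
    (h1 a b e d a' b' e' d' q ha hb he hd ha' hb' he' hd' hq hid)

/-- **The skeleton theorem** (the child's statement verbatim; re-point at the route decl after the split).
[cite: Deligne1982HodgeCycles, Thm. 7.18] -/
theorem BetaProductHodgeType_of : ∀ (a b e d a' b' e' d' : ℚ) (q : ℝ), 0 < a → 0 < b → 0 < e → 0 < d → 0 < a' → 0 < b' → 0 < e' → 0 < d' → IsAlgebraic ℚ q → ProbabilityTheory.beta (a:ℝ) b * ProbabilityTheory.beta (e:ℝ) d = q * (ProbabilityTheory.beta (a':ℝ) b' * ProbabilityTheory.beta (e':ℝ) d') → ∀ u : ℕ, 0 < u → Nat.Coprime u a.den → Nat.Coprime u b.den → Nat.Coprime u e.den → Nat.Coprime u d.den → Nat.Coprime u a'.den → Nat.Coprime u b'.den → Nat.Coprime u e'.den → Nat.Coprime u d'.den → (Int.fract ((u:ℚ) * a) + Int.fract ((u:ℚ) * b) - Int.fract ((u:ℚ) * (a + b)))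 + (Int.fract ((u:ℚ) * e) + Int.fract ((u:ℚ) * d) - Int.fract ((u:ℚ) * (e + d))) = (Int.fract ((u:ℚ) * a') + Int.fract ((u:ℚ) * b') - Int.fract ((u:ℚ) * (a' + b'))) + (Int.fract ((u:ℚ) * e') + Int.fract ((u:ℚ) * d') - Int.fract ((u:ℚ) * (e' + d'))) :=
  betaProductHodgeType_of_stubs stub_relSpan_of_algebraic stub_hodge_of_relSpan

end Summit.KontsevichZagierPeriods.KontsevichZagierPeriods.Cruxes.BetaProductHodgeType.Birth

end
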